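import Summits.Ventures.PercRepro.RankLevelSetHallRuleL

/-!
# PercRepro — THE FLAT-SHARE KERNEL (KERNEL A) AT EVERY TIGHT LAYER: LOADS ≤ 1, AND THE TRANSFER TO THE UP-HALL FORM
(p4, gen 37; paper proofs/P4-CRUX-K2.md Addendum 2; C-044, UP form, tight layer `#E = p + q`, any `k = p − q ≥ 2`)

The kernel that proves the crux at `k = 2` (RankLevelSetHallCoopShare…) generalises to every tight layer: on the MIDDLE levels
(`#S < p`) every `Y`-set pays `1/C(#S, q)` to each member inside it (night-1's Rule L split); on the BIG sets (`#S ≥ p`) a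
`Y`-set `S` splits one unit evenly among the closure flats of its **first-hit members** — the members `Z ⊆ S` with
`#(S ∖ cl Z) = r(S) − q` (`FirstHit`) — and the share of a flat evenly among the first-hit members of `S` with that closure
(`fhFlats`, `fhClass`, `fsWeight`).  THIS FILE: the weight is non-negative, supported on `Z ⊆ S`, and **every `Y`-set is
loaded at most `1`** (`fsWeight_load_le_one`: the middle levels by `ncard_members_subset_le_choose`, the big sets by the
partition of the first-hit members by their closure).  `FlatShareRecv M p q` (a `Prop`, NOT asserted: every member receives at
least `Φ(p,q)`) therefore gives the UP-Hall condition for every family (`hallUp_of_ncard_eq_of_flatShare`).  At `k = 2`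
`FlatShareRecv` is the theorem of RankLevelSetHallCoopShareReceipt (the big part = the coloop-share kernel); for `k ≥ 3` it is
the conjecture of record — 80 adversarial climbs (kit j330503, `k = 3, 4, 5`, `n ≤ 12`) and the «lost circuit + fat class» model
to `q = 40` never go below `Φ`, with equality exactly at the members without lost sets.

* `FirstHit`, `fhFlats`, `fhClass`, `fsWeight`;
* `fhFlats_finite`, `fhClass_finite`, `fsWeight_nonneg`, `subset_of_fsWeight_ne_zero`;
* **`fsWeight_load_le_one`** — `#E = p + q` ⇒ every `Y`-set is loaded at most `1`;
* `FlatShareRecv`, **`hallUp_of_ncard_eq_of_flatShare`**.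
Axioms: standard.
-/

namespace PercRepro

open Set Matroid Finset

variable {α : Type} (M : Matroid α) [M.Finite]

/-- `Z` is a **first-hit member** of `S`: a member inside `S` with `#(S ∖ cl Z) + q = r(S)` (the part of `S` outside the
closure of `Z` is as small as the rank allows — independent over `cl Z`). -/
def FirstHit (p q : ℕ) (S Z : Set α) : Prop :=
  Z ∈ cellMembers M p q ∧ Z ⊆ S ∧ (((S \ M.closure Z).ncard : ℕ) : ℕ∞) + (q : ℕ∞) = M.eRk S

/-- The closure flats of the first-hit members of `S`. -/
def fhFlats (p q : ℕ) (S : Set α) : Set (Set α) := {G | ∃ Z, FirstHit M p q S Z ∧ M.closure Z = G}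

/-- The first-hit members of `S` with closure `G`. -/
def fhClass (p q : ℕ) (S G : Set α) : Set (Set α) := {Z | FirstHit M p q S Z ∧ M.closure Z = G}

/-- **The flat-share weight** of the member `Z` at the `Y`-set `S`: `1/C(#S, q)` on the middle levels (`#S < p`); on the big
sets `1 / (#fhFlats S · #fhClass S (cl Z))` when `Z` is a first-hit member of `S`, `0` otherwise. -/
noncomputable def fsWeight (p q : ℕ) (Z S : Set α) : ℚ := by
  classical
  exact if Z ∈ cellMembers M p q ∧ Z ⊆ S ∧ S ∈ cellY M p q then
    (if S.ncard < p then 1 / ((S.ncard.choose q : ℕ) : ℚ)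
     else if FirstHit M p q S Z then
       1 / (((fhFlats M p q S).ncard : ℚ) * ((fhClass M p q S (M.closure Z)).ncard : ℚ))
     else 0)
  else 0

omit [M.Finite] in
/-- The first-hit members of `S` with closure `G` are members. -/
theorem fhClass_subset (p q : ℕ) (S G : Set α) : fhClass M p q S G ⊆ cellMembers M p q := fun _ hZ => hZ.1.1

/-- The classes are finite. -/
theorem fhClass_finite (p q : ℕ) (S G : Set α) : (fhClass M p q S G).Finite :=
  (cellMembers_finite M p q).subset (fhClass_subset M p q S G)

/-- The first-hit flats of `S` are finitely many (closures of members). -/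
theorem fhFlats_finite (p q : ℕ) (S : Set α) : (fhFlats M p q S).Finite := by
  refine ((cellMembers_finite M p q).image M.closure).subset ?_
  rintro G ⟨Z, hZ, rfl⟩
  exact ⟨Z, hZ.1, rfl⟩

omit [M.Finite] in
/-- The weight is non-negative. -/
theorem fsWeight_nonneg (p q : ℕ) (Z S : Set α) : 0 ≤ fsWeight M p q Z S := by
  classical
  unfold fsWeight
  split_ifs <;> positivity

omit [M.Finite] in
/-- The weight is supported on the pairs `Z ⊆ S`. -/
theorem subset_of_fsWeight_ne_zero (p q : ℕ) (Z S : Set α) (h : fsWeight M p q Z S ≠ 0) : Z ⊆ S := by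
  classical
  by_contra hZS
  apply h
  unfold fsWeight
  rw [if_neg (fun hc => hZS hc.2.1)]

open Classical in
omit [M.Finite] in
/-- On a big `Y`-set the weight of `Z` is its class share when `Z` is first-hit, `0` otherwise. -/
theorem fsWeight_big (p q : ℕ) {Z S : Set α} (hZ : Z ∈ cellMembers M p q) (hS : S ∈ cellY M p q) (hbig : ¬ S.ncard < p) :
    fsWeight M p q Z S = if FirstHit M p q S Z then
      1 / (((fhFlats M p q S).ncard : ℚ) * ((fhClass M p q S (M.closure Z)).ncard : ℚ)) else 0 := by
  unfold fsWeight
  by_cases hZS : Z ⊆ S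
  · rw [if_pos ⟨hZ, hZS, hS⟩, if_neg hbig]
  · have hnot : ¬ (Z ∈ cellMembers M p q ∧ Z ⊆ S ∧ S ∈ cellY M p q) := fun hc => hZS hc.2.1
    have hnfh : ¬ FirstHit M p q S Z := fun hc => hZS hc.2.1
    rw [if_neg hnot, if_neg hnfh]

open Classical in
/-- **Every `Y`-set is loaded at most `1`** at the tight layer: the middle levels pay `1/C(#S,q)` to at most `C(#S,q)`
members; a big set pays `1/#fhFlats` to each of its first-hit flats, split among the class of that flat. -/
theorem fsWeight_load_le_one (p q : ℕ) (hE : M.E.ncard = p + q) {S : Set α} (hS : S ∈ cellY M p q) :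
    ∑ Z ∈ (cellMembers_finite M p q).toFinset, fsWeight M p q Z S ≤ 1 := by
  classical
  set Mf : Finset (Set α) := (cellMembers_finite M p q).toFinset with hMf
  have hmemM : ∀ Z, Z ∈ Mf ↔ Z ∈ cellMembers M p q := fun Z => by
    rw [hMf, (cellMembers_finite M p q).mem_toFinset]
  by_cases hsmall : S.ncard < p
  · -- the LYM split (night-1's argument)
    have hw : ∀ Z ∈ Mf, fsWeight M p q Z S = if Z ⊆ S then 1 / ((S.ncard.choose q : ℕ) : ℚ) else 0 := by
      intro Z hZ
      rw [hmemM] at hZ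
      unfold fsWeight
      by_cases hZS : Z ⊆ S
      · rw [if_pos ⟨hZ, hZS, hS⟩, if_pos hsmall, if_pos hZS]
      · rw [if_neg (fun hc => hZS hc.2.1), if_neg hZS]
    rw [Finset.sum_congr rfl hw, Finset.sum_ite, Finset.sum_const_zero, add_zero, Finset.sum_const, nsmul_eq_mul]
    have hcount : (Mf.filter (fun Z => Z ⊆ S)).card ≤ S.ncard.choose q := by
      have h := ncard_members_subset_le_choose M hE hS.1
      have heq : {Z : Set α | Z ∈ cellMembers M p q ∧ Z ⊆ S}
          = ((Mf.filter (fun Z => Z ⊆ S) : Finset (Set α)) : Set (Set α)) := by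
        ext Z
        rw [Finset.coe_filter, Set.mem_setOf_eq, Set.mem_setOf_eq, hmemM]
      rw [heq, ncard_coe_finset] at h
      exact h
    have hpos : (0 : ℚ) < ((S.ncard.choose q : ℕ) : ℚ) := by
      have hq : q ≤ S.ncard := by
        obtain ⟨hSE, hqS, -⟩ := hS
        have h1 : (q : ℕ∞) ≤ M.eRk S := le_of_lt hqS
        have h2 : M.eRk S ≤ S.encard := M.eRk_le_encard S
        rw [← (M.set_finite S hSE).cast_ncard_eq] at h2
        exact_mod_cast h1.trans h2
      exact_mod_cast Nat.choose_pos hq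
    rw [mul_one_div, div_le_one hpos]
    exact_mod_cast hcount
  · -- a big set: partition the first-hit members by their closure
    set Ff : Finset (Set α) := (fhFlats_finite M p q S).toFinset with hFf
    have hmemF : ∀ G, G ∈ Ff ↔ G ∈ fhFlats M p q S := fun G => by
      rw [hFf, (fhFlats_finite M p q S).mem_toFinset]
    have hFcard : Ff.card = (fhFlats M p q S).ncard := by
      rw [hFf, ← ncard_eq_toFinset_card _ (fhFlats_finite M p q S)]
    have hpt : ∀ Z ∈ Mf, fsWeight M p q Z S = ∑ G ∈ Ff, (if Z ∈ fhClass M p q S G then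
        1 / (((fhFlats M p q S).ncard : ℚ) * ((fhClass M p q S G).ncard : ℚ)) else 0) := by
      intro Z hZ
      rw [hmemM] at hZ
      rw [fsWeight_big M p q hZ hS hsmall]
      by_cases hfh : FirstHit M p q S Z
      · rw [if_pos hfh, Finset.sum_eq_single (M.closure Z)]
        · rw [if_pos ⟨hfh, rfl⟩]
        · intro G _ hne
          rw [if_neg]
          intro hc
          exact hne hc.2.symm
        · intro hnot
          exact absurd ((hmemF _).2 ⟨Z, hfh, rfl⟩) hnot
      · rw [if_neg hfh]
        symm
        apply Finset.sum_eq_zero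
        intro G _
        rw [if_neg]
        intro hc
        exact hfh hc.1
    rw [Finset.sum_congr rfl hpt, Finset.sum_comm]
    have hclass : ∀ G ∈ Ff, (∑ Z ∈ Mf, (if Z ∈ fhClass M p q S G then
        1 / (((fhFlats M p q S).ncard : ℚ) * ((fhClass M p q S G).ncard : ℚ)) else 0))
        = 1 / ((fhFlats M p q S).ncard : ℚ) := by
      intro G hG
      rw [hmemF] at hG
      rw [Finset.sum_ite, Finset.sum_const_zero, add_zero, Finset.sum_const, nsmul_eq_mul]
      have hcount : ((Mf.filter (fun Z => Z ∈ fhClass M p q S G)).card : ℚ) = ((fhClass M p q S G).ncard : ℚ) := by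
        have heq : fhClass M p q S G = ((Mf.filter (fun Z => Z ∈ fhClass M p q S G) : Finset (Set α)) : Set (Set α)) := by
          ext Z
          rw [Finset.coe_filter, Set.mem_setOf_eq, hmemM]
          exact ⟨fun h => ⟨h.1.1, h⟩, fun h => h.2⟩
        have h1 := congrArg Set.ncard heq
        rw [ncard_coe_finset] at h1
        exact_mod_cast h1.symm
      have hpos : (0 : ℚ) < ((fhClass M p q S G).ncard : ℚ) := by
        obtain ⟨Z, hZ, rfl⟩ := hG
        have hne : (fhClass M p q S (M.closure Z)).Nonempty := ⟨Z, hZ, rfl⟩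
        have := (Set.ncard_pos (fhClass_finite M p q S _)).2 hne
        exact_mod_cast this
      rw [hcount]
      field_simp
    rw [Finset.sum_congr rfl hclass, Finset.sum_const, nsmul_eq_mul, hFcard]
    by_cases hF : (fhFlats M p q S).ncard = 0
    · rw [hF]; simp
    · have hpos : (0 : ℚ) < ((fhFlats M p q S).ncard : ℚ) := by
        exact_mod_cast Nat.pos_of_ne_zero hF
      rw [mul_one_div, div_self hpos.ne']

/-- **The flat-share receipt condition** (a `Prop`, NOT asserted): every member receives at least `Φ(p,q)` under the
flat-share kernel.  A theorem at `k = 2` (RankLevelSetHallCoopShareReceipt), the conjecture of record for `k ≥ 3`. -/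
def FlatShareRecv (p q : ℕ) : Prop :=
  ∀ Z ∈ cellMembers M p q, phiK p q ≤ ∑ S ∈ (cellY_finite M p q).toFinset, fsWeight M p q Z S

/-- **THE TRANSFER**: at the tight layer `#E = p + q`, `FlatShareRecv M p q` gives the UP-Hall condition for every family of
members (through night-1's `hallUp_of_fracMatching`). -/
theorem hallUp_of_ncard_eq_of_flatShare (p q : ℕ) (hE : M.E.ncard = p + q) (h : FlatShareRecv M p q)
    (𝒜 : Set (Set α)) (h𝒜 : 𝒜 ⊆ cellMembers M p q) :
    phiK p q * (𝒜.ncard : ℚ) ≤ ((upNbhd M p q 𝒜).ncard : ℚ) :=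
  hallUp_of_fracMatching M p q (fsWeight M p q) (fsWeight_nonneg M p q) (subset_of_fsWeight_ne_zero M p q)
    (fun _ hZ => h _ hZ) (fun _ hS => fsWeight_load_le_one M p q hE hS) 𝒜 h𝒜

end PercRepro
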